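import Literature.Analysis.Calculus.IteratedFDerivBlockReaderBounds       -- ★ p851230∕p851232 (this seat) (E1)(E2): block-reader induction + block `ℓ^∞` packaging
import Literature.NumberTheory.Rogawski1990.ArchOrbFamGExtFaceJetBounds     -- ★ (B2) (LH3-p02 (g4)): `norm_iteratedFDeriv_comp_clm_le_of_isOpen` (jets of a pull-back along a CLM)
import HarnessLib

/-!
# (E4) BLOCK PEELING, S-FORM — an `m`-fold nested BLOCK reader of a jointly smooth, compactly supported block function is smooth off the walls with every jet bounded on
# `(S ∩ Q) ×ˢ (T ∩ T₀)^m` (Varadarajan 1977 I §1.12; Bouaziz 1994 §3.1 (I₁)–(I₂); Hörmander ALPDO I §1.1, §2.1)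

Topic `Analysis/Calculus`; namespace `Literature.Analysis.Calculus` (generic).  THEOREMS ONLY (no `def`, no instance, no notation, no axiom, no named fact, no `sorry`).  Cell
`pub/hodgecm-mathlib`, crux H413 (`stmt-HodgeConjecture-24833`), F0∕P3c line LH3 (leaf `F0_P3c_StubN9Direct` v5.1), organ **O-L1d′ `stub_N9hcCentralMixedJetBounds`** (`hCm`: scalar corner
at one compact place AND singular at another); LH3-plan (g4) deal (n1) «O-L1d′ ENGINE» (F0P3a-p08 (g23)), brick (E4).

THIS IS THE BLOCK TWIN OF ★ (X3-asm) `contDiffOn_and_forall_bound_nestedReader` (F0P3a-p02 (g21)) WITH TWO CHANGES: (1) the transversal variable of each block lives in a finite-dimensional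
BLOCK `V` (face reader: `V = ℝ`; CENTRAL reader at a scalar compact place: `V = Fin 3 → ℝ`, `T` = chambers ∩ ball), the READERS ARE INDEXED, `Φ : ι → (M → E) → V → E` (at scalar places the reader depends on the place `w` through `G_w, ν_w, ζ_w`, so `ι` = places), a slot
sequence `e : ℕ → ι` says which reader peels which slot, the tower is `H e m P′ : (P′ × (Fin m → M) → E) → (P′ × (Fin m → V) → E)` (peel: `H e (m+1) = Φ (e 0) ∘ H (e ∘ succ) m`),
and `hunif`∕`hread` are the block binders of ★ (E1)(E2) for every `Φ i`; (2) **S-FORM**: the bound set is `(S ∩ Q) ×ˢ (T ∩ T₀)^m` for an ARBITRARY `S ⊆ P` on which the base function's joint jets are bounded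
(`hfbd : ∀ n, ∃ B, ∀ z ∈ (S ∩ Q) ×ˢ univ, ‖Dⁿ f z‖ ≤ B`), instead of a compact `K ⊆ Q` — because the MIXED organ is TWO-STAGE (stage 1: ★ (X3-asm) face peeling with the central block
variables as smooth parameters; stage 2: this file's central peeling over the base `f₂ ((q, ψ), X) := H_face (…)`, whose parameter set `Q ×ˢ T_face^{m₁}` is open but whose bound set
`K ×ˢ (T ∩ T₀)_face^{m₁}` is NOT compact in it).  The compact-`K` form is the corollary `…_of_isCompact`.
PROOF = p02's induction verbatim in block currency: the parameter space grows by one block factor `M` per peel; the outer family `g (q, θ′) := X₀ ↦ H m f̃ ((q, X₀), θ′)` over the open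
`O = Q ×ˢ T^m` lies in the admissible class «smooth on `O ×ˢ univ`, one compact support, jointly bounded jets on `(S′ ∩ O) ×ˢ univ`», `S′ = S ×ˢ T₀^m` (closed under parameter derivatives by
★ p02 §1); ★ (X3-CORE) §3 slices + ★ (E2) `…_on_inter` give `hbd`; ★ (E1) bounds every joint jet; the CLM re-indexing `(q, θ) ↦ ((q, Fin.tail θ), θ 0)` pulls back (★ (B2) §1).
HONEST LABEL: generic calculus; count-neutral; HC_CM is proved only modulo the 7 printed citations (2 remaining: hLiu418 = stmt-HodgeConjecture-24832, h413 = stmt-HodgeConjecture-24833)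
until rung 0 closes.

## References
* [Varadarajan1977] V. S. Varadarajan, *Harmonic Analysis on Real Reductive Groups*, LNM 576 (1977), Part I §1.12, §3.
* [Bouaziz1994IntegralesOrbitales] A. Bouaziz, *Intégrales orbitales sur les groupes de Lie réductifs*, Ann. Sci. ÉNS 27 (1994), §3.1 (I₁)–(I₂) p. 579, §3.2 p. 580.
* [HormanderALPDO1] L. Hörmander, *The Analysis of Linear Partial Differential Operators I*, 2nd ed. (1990), §1.1 Thm. 1.1.8, (1.1.9); §2.1.
-/

set_option autoImplicit false

noncomputable section

open Set Filter Topology Function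
open scoped ContDiff ENNReal

namespace Literature.Analysis.Calculus

section GenericBlk

/-! Private copies (suffix `_blk`) of the six generic jet-bookkeeping lemmas of (X3-asm) `ArchOrbFamGExtCornerPeeling` §1 (F0P3a-p02 (g21), report-first
6e100ebae0afa4d8, not yet in the tree at filing time); they will be re-pointed to the ★ names in an edition once that file lands. -/

variable {V F : Type*} [NormedAddCommGroup V] [NormedSpace ℝ V] [NormedAddCommGroup F] [NormedSpace ℝ F]

/-- Jets vanish at a point near which the function vanishes. [cite: HormanderALPDO1, §1.1 (1.1.8)] -/
private theorem iteratedFDeriv_eq_zero_of_eventuallyEq_zero_blk {f : V → F} {x : V} (h : f =ᶠ[𝓝 x] fun _ => 0) (k : ℕ) : iteratedFDeriv ℝ k f x = 0 := by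
  rw [(h.iteratedFDeriv ℝ k).eq_of_nhds, iteratedFDeriv_fun_zero]
  rfl

/-- **Jets of a directional derivative against the next full jet**: for `G` of class `C^∞` on an open `U` and `z ∈ U`, `‖Dᵏ (z ↦ DG(z) w) z‖ ≤ ‖w‖ · ‖Dᵏ⁺¹ G z‖`.
[cite: HormanderALPDO1, §1.1 Thm. 1.1.8] -/
private theorem norm_iteratedFDeriv_fderiv_apply_le_of_isOpen_blk {G : V → F} {U : Set V} (hU : IsOpen U) (hG : ContDiffOn ℝ ∞ G U) (w : V) {z : V} (hz : z ∈ U) (k : ℕ) :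
    ‖iteratedFDeriv ℝ k (fun y => fderiv ℝ G y w) z‖ ≤ ‖w‖ * ‖iteratedFDeriv ℝ (k + 1) G z‖ := by
  have hGz : ContDiffAt ℝ ∞ G z := hG.contDiffAt (hU.mem_nhds hz)
  have hf : ContDiffAt ℝ k (fderiv ℝ G) z := hGz.fderiv_right (by exact_mod_cast le_top)
  calc ‖iteratedFDeriv ℝ k (fun y => fderiv ℝ G y w) z‖ ≤ ‖w‖ * ‖iteratedFDeriv ℝ k (fderiv ℝ G) z‖ := norm_iteratedFDeriv_clm_apply_const hf le_rfl
    _ = ‖w‖ * ‖iteratedFDeriv ℝ (k + 1) G z‖ := by rw [norm_iteratedFDeriv_fderiv]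

variable {P M : Type*} [NormedAddCommGroup P] [NormedSpace ℝ P] [NormedAddCommGroup M] [NormedSpace ℝ M]

/-- **The parameter derivative of a family is the total derivative of `uncurry` on `(v, 0)`** (where `uncurry g` is differentiable). [cite: HormanderALPDO1, §1.1 (1.1.3)] -/
private theorem fderiv_apply_eq_fderiv_uncurry_blk {g : P → M → F} {q : P} {X : M} (h : DifferentiableAt ℝ (uncurry g) (q, X)) (v : P) :
    fderiv ℝ (fun q' => g q' X) q v = fderiv ℝ (uncurry g) (q, X) (v, 0) := by
  have hc : HasFDerivAt ((uncurry g) ∘ fun q' : P => (q', X)) ((fderiv ℝ (uncurry g) (q, X)).comp (ContinuousLinearMap.inl ℝ P M)) q :=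
    h.hasFDerivAt.comp q (hasFDerivAt_prodMk_left (𝕜 := ℝ) q X)
  rw [show (fun q' : P => g q' X) = (uncurry g) ∘ fun q' : P => (q', X) from rfl, hc.fderiv, ContinuousLinearMap.comp_apply, ContinuousLinearMap.inl_apply]

/-- **The parameter-derivative family is smooth on `O ×ˢ univ`** when the family is (open `O`): `uncurry (q ↦ X ↦ ∂_v (q′ ↦ g q′ X) q)` agrees on `O ×ˢ univ` with
`z ↦ D(uncurry g)(z)(v, 0)`. [cite: HormanderALPDO1, §1.1 Thm. 1.1.8] -/
private theorem contDiffOn_uncurry_fderiv_apply_blk {g : P → M → F} {O : Set P} (hO : IsOpen O) (hg : ContDiffOn ℝ ∞ (uncurry g) (O ×ˢ univ)) (v : P) :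
    ContDiffOn ℝ ∞ (uncurry fun q X => fderiv ℝ (fun q' => g q' X) q v) (O ×ˢ (univ : Set M)) := by
  have hU : IsOpen (O ×ˢ (univ : Set M)) := hO.prod isOpen_univ
  have hGf : ContDiffOn ℝ ∞ (fun z => fderivWithin ℝ (uncurry g) (O ×ˢ univ) z ((v, 0) : P × M)) (O ×ˢ univ) :=
    (hg.fderivWithin hU.uniqueDiffOn (by simp)).clm_apply contDiffOn_const
  refine hGf.congr fun z hz => ?_
  have hd : DifferentiableAt ℝ (uncurry g) (z.1, z.2) := (hg.differentiableOn (by simp) z hz).differentiableAt (hU.mem_nhds hz)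
  show fderiv ℝ (fun q' => g q' z.2) z.1 v = _
  rw [fderiv_apply_eq_fderiv_uncurry_blk hd v, fderivWithin_of_isOpen hU hz]

/-- **Joint jet bounds pass to the parameter-derivative family**: on `O ×ˢ univ`, `‖Dᵏ (uncurry (∂_v g)) z‖ ≤ ‖v‖ · ‖Dᵏ⁺¹ (uncurry g) z‖`. [cite: HormanderALPDO1, §1.1 Thm. 1.1.8] -/
private theorem norm_iteratedFDeriv_uncurry_fderiv_apply_le_blk {g : P → M → F} {O : Set P} (hO : IsOpen O) (hg : ContDiffOn ℝ ∞ (uncurry g) (O ×ˢ univ)) (v : P)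
    {z : P × M} (hz : z ∈ O ×ˢ (univ : Set M)) (k : ℕ) :
    ‖iteratedFDeriv ℝ k (uncurry fun q X => fderiv ℝ (fun q' => g q' X) q v) z‖ ≤ ‖v‖ * ‖iteratedFDeriv ℝ (k + 1) (uncurry g) z‖ := by
  have hU : IsOpen (O ×ˢ (univ : Set M)) := hO.prod isOpen_univ
  have hev : (uncurry fun q X => fderiv ℝ (fun q' => g q' X) q v) =ᶠ[𝓝 z] fun y => fderiv ℝ (uncurry g) y ((v, 0) : P × M) := by
    filter_upwards [hU.mem_nhds hz] with y hy
    have hd : DifferentiableAt ℝ (uncurry g) (y.1, y.2) := (hg.differentiableOn (by simp) y hy).differentiableAt (hU.mem_nhds hy)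
    exact fderiv_apply_eq_fderiv_uncurry_blk hd v
  rw [(hev.iteratedFDeriv ℝ k).eq_of_nhds]
  refine (norm_iteratedFDeriv_fderiv_apply_le_of_isOpen_blk hU hg ((v, 0) : P × M) hz k).trans ?_
  have hn : ‖((v, 0) : P × M)‖ = ‖v‖ := by rw [Prod.norm_mk, norm_zero, max_eq_left (norm_nonneg v)]
  rw [hn]

omit [NormedAddCommGroup M] [NormedSpace ℝ M] in
/-- Support of the parameter-derivative family: where the family vanishes for all parameters of the open `O`, so does `∂_v g` (`O` open). [cite: HormanderALPDO1, §1.1] -/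
private theorem fderiv_apply_eq_zero_of_forall_mem_blk {g : P → M → F} {O : Set P} (hO : IsOpen O) {X : M} (h0 : ∀ q ∈ O, g q X = 0) {q : P} (hq : q ∈ O) (v : P) :
    fderiv ℝ (fun q' => g q' X) q v = 0 := by
  have hev : (fun q' => g q' X) =ᶠ[𝓝 q] fun _ => (0 : F) := by
    filter_upwards [hO.mem_nhds hq] with q' hq' using h0 q' hq'
  rw [hev.fderiv_eq, fderiv_const_apply]
  rfl

end GenericBlk

section SlicesBlk

/-! Private copies (suffix `_blk`) of the (X3-CORE) §3 slice lemmas of ★ p851242 `ArchOrbFamGExtCornerReaders` (F0P3a-p02 (g21)) — inlined because the farm had no olean of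
that module at filing time; same statements, same proofs. -/

variable {P M F : Type*} [NormedAddCommGroup P] [NormedSpace ℝ P] [NormedAddCommGroup M] [NormedSpace ℝ M] [NormedAddCommGroup F] [NormedSpace ℝ F]

/-- **The partial jet of a slice is bounded by the full jet**: for `R` of class `Cᵐ` on an open `O ⊆ P × M` and `(q, X) ∈ O`, `‖Dᵐ (X′ ↦ R (q, X′)) X‖ ≤ ‖Dᵐ R (q, X)‖` (the slice is
`R ∘ (· + (q, 0)) ∘ inr`; ★ (B2) §1 `norm_iteratedFDeriv_comp_clm_le_of_isOpen` along the CLM `inr` of norm `≤ 1`, Mathlib `iteratedFDeriv_comp_add_right` for the translation).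
[cite: HormanderALPDO1, §1.1 (1.1.8)] -/
private theorem norm_iteratedFDeriv_slice_le_of_isOpen_blk (R : P × M → F) {O : Set (P × M)} (hO : IsOpen O) {m : ℕ} (hR : ContDiffOn ℝ m R O) {q : P} {X : M} (h : (q, X) ∈ O) :
    ‖iteratedFDeriv ℝ m (fun X' : M => R (q, X')) X‖ ≤ ‖iteratedFDeriv ℝ m R (q, X)‖ := by
  -- the translated function and the open preimage
  set Rq : P × M → F := fun z => R (z + (q, 0)) with hRq
  have hpre : IsOpen ((fun z : P × M => z + (q, 0)) ⁻¹' O) := hO.preimage (continuous_id.add continuous_const)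
  have hRqs : ContDiffOn ℝ m Rq ((fun z : P × M => z + (q, 0)) ⁻¹' O) := hR.comp (contDiff_id.add contDiff_const).contDiffOn fun z hz => hz
  have hslice : (fun X' : M => R (q, X')) = Rq ∘ (ContinuousLinearMap.inr ℝ P M) := by
    funext X'
    simp only [hRq, comp_apply, ContinuousLinearMap.inr_apply, Prod.mk_add_mk, zero_add, add_zero]
  have hX : (ContinuousLinearMap.inr ℝ P M) X ∈ (fun z : P × M => z + (q, 0)) ⁻¹' O := by
    simp only [mem_preimage, ContinuousLinearMap.inr_apply, Prod.mk_add_mk, zero_add, add_zero]; exact h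
  rw [hslice]
  refine (norm_iteratedFDeriv_comp_clm_le_of_isOpen (ContinuousLinearMap.inr ℝ P M) hpre hRqs hX).trans ?_
  have htr : iteratedFDeriv ℝ m Rq ((ContinuousLinearMap.inr ℝ P M) X) = iteratedFDeriv ℝ m R (q, X) := by
    rw [hRq, iteratedFDeriv_comp_add_right m (q, (0 : M)) ((ContinuousLinearMap.inr ℝ P M) X)]
    simp only [ContinuousLinearMap.inr_apply, Prod.mk_add_mk, zero_add, add_zero]
  rw [htr]
  have hn : ‖ContinuousLinearMap.inr ℝ P M‖ ≤ 1 := ContinuousLinearMap.opNorm_le_bound _ zero_le_one fun x => by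
    rw [one_mul, ContinuousLinearMap.inr_apply, Prod.norm_mk, norm_zero, max_eq_right (norm_nonneg x)]
  calc ‖ContinuousLinearMap.inr ℝ P M‖ ^ m * ‖iteratedFDeriv ℝ m R (q, X)‖ ≤ 1 ^ m * ‖iteratedFDeriv ℝ m R (q, X)‖ := by
        gcongr
    _ = ‖iteratedFDeriv ℝ m R (q, X)‖ := by rw [one_pow, one_mul]

/-- **Slices of a jointly bounded function form a `C^∞`-bounded family**: if the jets of `R` (smooth on the open `O ⊇ S ×ˢ C`) of every order are bounded on `S ×ˢ C`, then the slices
`{X ↦ R (s, X)}_{s ∈ S}` have jets of every order bounded on `C` uniformly in `s` — the `hbd` input of §2. [cite: HormanderALPDO1, §1.1 (1.1.8); §2.1] -/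
private theorem exists_forall_slice_bounds_of_bddAbove_blk (R : P × M → F) {O : Set (P × M)} (hO : IsOpen O) (hR : ContDiffOn ℝ ∞ R O) (S : Set P) (C : Set M) (hSC : S ×ˢ C ⊆ O)
    (hb : ∀ m : ℕ, BddAbove ((fun z => ‖iteratedFDeriv ℝ m R z‖) '' (S ×ˢ C))) (m : ℕ) :
    ∃ B : ℝ, ∀ s ∈ S, ∀ X ∈ C, ‖iteratedFDeriv ℝ m (fun X' : M => R (s, X')) X‖ ≤ B := by
  obtain ⟨B, hB⟩ := hb m
  exact ⟨B, fun s hs X hX => (norm_iteratedFDeriv_slice_le_of_isOpen_blk R hO (hR.of_le (mod_cast le_top)) (hSC (mk_mem_prod hs hX))).trans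
    (hB ⟨(s, X), mk_mem_prod hs hX, rfl⟩)⟩

/-- **A slice of a function smooth on `Q ×ˢ univ` is smooth** (`q ∈ Q`). [cite: HormanderALPDO1, §1.1 (1.1.8)] -/
private theorem contDiff_slice_of_contDiffOn_prod_univ_blk (R : P × M → F) {Q : Set P} (hR : ContDiffOn ℝ ∞ R (Q ×ˢ (univ : Set M))) {q : P} (hq : q ∈ Q) :
    ContDiff ℝ ∞ fun X : M => R (q, X) := by
  have hmaps : MapsTo (fun X : M => ((q, X) : P × M)) univ (Q ×ˢ (univ : Set M)) := fun X _ => mk_mem_prod hq (mem_univ X)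
  have h : ContDiffOn ℝ ∞ (fun X : M => R (q, X)) univ := hR.comp (contDiff_const.prodMk contDiff_id).contDiffOn hmaps
  exact contDiffOn_univ.1 h

omit [NormedAddCommGroup P] [NormedSpace ℝ P] [NormedSpace ℝ M] [NormedSpace ℝ F] in
/-- **Uniform compact support of the slices**: if `R (s, X) = 0` for `X ∉ C` with `C` closed, then `tsupport (X ↦ R (s, X)) ⊆ C`. [cite: HormanderALPDO1, §2.1] -/
private theorem tsupport_slice_subset_blk (R : P × M → F) {C : Set M} (hC : IsClosed C) {s : P} (h0 : ∀ X, X ∉ C → R (s, X) = 0) :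
    tsupport (fun X : M => R (s, X)) ⊆ C :=
  closure_minimal (fun X hX => by
    by_contra hXC
    exact hX (h0 X hXC)) hC

end SlicesBlk

section Peeling

variable {M E : Type} [NormedAddCommGroup M] [NormedSpace ℝ M] [FiniteDimensional ℝ M] [NormedAddCommGroup E] [NormedSpace ℝ E]
  {V : Type} [NormedAddCommGroup V] [NormedSpace ℝ V] [FiniteDimensional ℝ V]

/-- **BLOCK PEELING, S-FORM.**  Data: a block reader `Φ : (M → E) → V → E` with CLM-uniform transversal bounds on `T ∩ T₀` at every `ℓ^∞(J, E)` (`hunif`, block form of ★ (E2)) and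
reader data on open parameter sets (`hread`: the joint function `z ↦ Φ (g z.1) z.2` is smooth on `O ×ˢ T` and `∂_{(v,0)}` of it is the reader of the parameter derivative, for families
smooth on `O ×ˢ univ` with one compact support); a tower `H m P′ : (P′ × (Fin m → M) → E) → (P′ × (Fin m → V) → E)` with `H 0 f (q, ·) = f (q, ·)` (`hH0`), the PEELING identity
`H (m+1) f (q, θ) = Φ (X₀ ↦ H m f̃ ((q, X₀), Fin.tail θ)) (θ 0)`, `f̃ ((q, X₀), X′) = f (q, Fin.cons X₀ X′)` (`hHsucc`, for `f` smooth on `Q ×ˢ univ` with one compact block support,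
`q ∈ Q`, `θ ∈ T^{m+1}`) and `H m f (q, θ) = 0` when `f (q, ·) ≡ 0` (`hHzero`).  Conclusion, for every `m`, finite-dimensional `P`, open `Q ⊆ P`, `f` smooth on `Q ×ˢ univ` with
`f (q, X) = 0` whenever some `X k ∉ C` (`C` compact), and ANY `S ⊆ P` with `‖Dⁿ f‖` bounded on `(S ∩ Q) ×ˢ univ` for every `n` (`hfbd`):
`ContDiffOn ℝ ∞ (H m P f) (Q ×ˢ T^m)` and `∀ n, ∃ B, ∀ z ∈ (S ∩ Q) ×ˢ (T ∩ T₀)^m, ‖Dⁿ (H m P f) z‖ ≤ B`.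
[cite: Varadarajan1977, Part I §1.12] [cite: Bouaziz1994IntegralesOrbitales, §3.1 (I₁)–(I₂) p. 579; §3.2 p. 580] [cite: HormanderALPDO1, §1.1 Thm. 1.1.8, (1.1.9); §2.1] -/
theorem contDiffOn_and_forall_bound_nestedBlockReaders {ι : Type*} (Φ : ι → (M → E) → V → E) {T : Set V} (hT : IsOpen T) (T₀ : Set V)
    (hunif : ∀ (i : ι) (J : Type) (Gf : M → lp (fun _ : J => E) ⊤), ContDiff ℝ ∞ Gf → HasCompactSupport Gf → ∀ n : ℕ,
      ∃ B : ℝ, ∀ θ ∈ T ∩ T₀, ∀ ℓ : lp (fun _ : J => E) ⊤ →L[ℝ] E, ‖iteratedFDeriv ℝ n (Φ i (fun X => ℓ (Gf X))) θ‖ ≤ ‖ℓ‖ * B)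
    (hread : ∀ (i : ι) (P' : Type) [NormedAddCommGroup P'] [NormedSpace ℝ P'] [FiniteDimensional ℝ P'] (O : Set P'), IsOpen O → ∀ g : P' → M → E,
      ContDiffOn ℝ ∞ (uncurry g) (O ×ˢ univ) → (∃ C : Set M, IsCompact C ∧ ∀ q ∈ O, ∀ X, X ∉ C → g q X = 0) →
        ContDiffOn ℝ ∞ (fun z : P' × V => Φ i (g z.1) z.2) (O ×ˢ T) ∧
        ∀ (v : P') (z : P' × V), z ∈ O ×ˢ T → fderiv ℝ (fun z : P' × V => Φ i (g z.1) z.2) z (v, 0) = Φ i (fun X => fderiv ℝ (fun q' => g q' X) z.1 v) z.2)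
    (H : (ℕ → ι) → ∀ (m : ℕ) (P' : Type), (P' × (Fin m → M) → E) → (P' × (Fin m → V) → E))
    (hH0 : ∀ (e : ℕ → ι) (P' : Type) (f : P' × (Fin 0 → M) → E) (q : P') (θ : Fin 0 → V), H e 0 P' f (q, θ) = f (q, fun k => k.elim0))
    (hHsucc : ∀ (e : ℕ → ι) (m : ℕ) (P' : Type) [NormedAddCommGroup P'] [NormedSpace ℝ P'] (Q : Set P'), IsOpen Q →
      ∀ (f : P' × (Fin (m + 1) → M) → E),
      ContDiffOn ℝ ∞ f (Q ×ˢ univ) → (∃ C : Set M, IsCompact C ∧ ∀ (q : P') (X : Fin (m + 1) → M), (∃ k, X k ∉ C) → f (q, X) = 0) →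
      ∀ q ∈ Q, ∀ θ : Fin (m + 1) → V, (∀ k, θ k ∈ T) →
        H e (m + 1) P' f (q, θ) = Φ (e 0) (fun X₀ => H (fun k => e (k + 1)) m (P' × M) (fun p => f (p.1.1, Fin.cons p.1.2 p.2)) ((q, X₀), Fin.tail θ)) (θ 0))
    (hHzero : ∀ (e : ℕ → ι) (m : ℕ) (P' : Type) (f : P' × (Fin m → M) → E) (q : P') (θ : Fin m → V),
      (∀ X, f (q, X) = 0) → H e m P' f (q, θ) = 0)
    (m : ℕ) :
    ∀ (e : ℕ → ι) (P : Type) [NormedAddCommGroup P] [NormedSpace ℝ P] [FiniteDimensional ℝ P] (Q : Set P), IsOpen Q →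
      ∀ (f : P × (Fin m → M) → E), ContDiffOn ℝ ∞ f (Q ×ˢ univ) → ∀ (C : Set M), IsCompact C → (∀ (q : P) (X : Fin m → M), (∃ k, X k ∉ C) → f (q, X) = 0) →
        ∀ (S : Set P), (∀ n : ℕ, ∃ B : ℝ, ∀ z ∈ (S ∩ Q) ×ˢ (univ : Set (Fin m → M)), ‖iteratedFDeriv ℝ n f z‖ ≤ B) →
          ContDiffOn ℝ ∞ (H e m P f) (Q ×ˢ Set.pi univ fun _ => T) ∧
            ∀ n : ℕ, ∃ B : ℝ, ∀ z ∈ (S ∩ Q) ×ˢ Set.pi univ (fun _ => T ∩ T₀), ‖iteratedFDeriv ℝ n (H e m P f) z‖ ≤ B := by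
  induction m with
  | zero =>
    intro e P _ _ _ Q hQ f hf C hC hfC S hfbd
    -- `H 0 P f = f ∘ ι`, `ι (q, θ) = (q, 0)` a CLM
    set ι0 : P × (Fin 0 → V) →L[ℝ] P × (Fin 0 → M) := (ContinuousLinearMap.fst ℝ P (Fin 0 → V)).prod 0 with hι0def
    have hι : ∀ z : P × (Fin 0 → V), ι0 z = (z.1, fun k => k.elim0) := fun z =>
      Prod.ext rfl (funext fun k => k.elim0)
    have hH : H e 0 P f = f ∘ ι0 := funext fun z => by rw [comp_apply, hι, ← hH0 e P f z.1 z.2]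
    have hQu : IsOpen (Q ×ˢ (univ : Set (Fin 0 → M))) := hQ.prod isOpen_univ
    have hmaps : MapsTo ι0 (Q ×ˢ univ) (Q ×ˢ univ) := fun z hz => by rw [hι]; exact ⟨hz.1, mem_univ _⟩
    have hpi : (Set.pi univ fun _ : Fin 0 => T) = univ := by ext θ; simp
    have hpi' : (Set.pi univ fun _ : Fin 0 => T ∩ T₀) = univ := by ext θ; simp
    refine ⟨by rw [hpi, hH]; exact hf.comp ι0.contDiff.contDiffOn hmaps, fun n => ?_⟩
    obtain ⟨B, hB⟩ := hfbd n
    refine ⟨‖ι0‖ ^ n * max B 0, fun z hz => ?_⟩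
    rw [hpi'] at hz
    have hzι : ι0 z ∈ Q ×ˢ (univ : Set (Fin 0 → M)) := hmaps ⟨hz.1.2, mem_univ _⟩
    rw [hH]
    refine (norm_iteratedFDeriv_comp_clm_le_of_isOpen ι0 hQu (hf.of_le (mod_cast le_top)) (n := n) hzι).trans ?_
    refine mul_le_mul_of_nonneg_left ((hB _ ?_).trans (le_max_left _ _)) (pow_nonneg (norm_nonneg _) _)
    rw [hι]; exact ⟨hz.1, mem_univ _⟩
  | succ m ih =>
    intro e P _ _ _ Q hQ f hf C hC hfC S hfbd
    -- the peeled data: parameters `P × M`, `f̃ ((q, X₀), X′) = f (q, Fin.cons X₀ X′)` — a CLM re-indexing of `f`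
    set κ : (P × M) × (Fin m → M) →L[ℝ] P × (Fin (m + 1) → M) :=
      ((ContinuousLinearMap.fst ℝ P M).comp (ContinuousLinearMap.fst ℝ (P × M) (Fin m → M))).prod
        (((Fin.consEquivL ℝ (fun _ : Fin (m + 1) => M)) : (M × (Fin m → M)) →L[ℝ] (Fin (m + 1) → M)).comp
          (((ContinuousLinearMap.snd ℝ P M).comp (ContinuousLinearMap.fst ℝ (P × M) (Fin m → M))).prod (ContinuousLinearMap.snd ℝ (P × M) (Fin m → M)))) with hκdef
    have hκ : ∀ p : (P × M) × (Fin m → M), κ p = (p.1.1, Fin.cons p.1.2 p.2) := fun p => rfl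
    set ft : (P × M) × (Fin m → M) → E := fun p => f (p.1.1, Fin.cons p.1.2 p.2) with hft
    have hftκ : ft = f ∘ κ := funext fun p => by rw [comp_apply, hκ]
    have hQt : IsOpen (Q ×ˢ (univ : Set M)) := hQ.prod isOpen_univ
    have hQu : IsOpen (Q ×ˢ (univ : Set (Fin (m + 1) → M))) := hQ.prod isOpen_univ
    have hκmaps : MapsTo κ ((Q ×ˢ (univ : Set M)) ×ˢ univ) (Q ×ˢ univ) := fun p hp => by rw [hκ]; exact ⟨hp.1.1, mem_univ _⟩
    have hft_s : ContDiffOn ℝ ∞ ft ((Q ×ˢ (univ : Set M)) ×ˢ univ) := by rw [hftκ]; exact hf.comp κ.contDiff.contDiffOn hκmaps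
    have hft_C : ∀ (p : P × M) (X' : Fin m → M), (∃ k, X' k ∉ C) → ft (p, X') = 0 := by
      rintro p X' ⟨k, hk⟩
      exact hfC p.1 _ ⟨k.succ, by rwa [Fin.cons_succ]⟩
    have hft_0 : ∀ (p : P × M), p.2 ∉ C → ∀ X', ft (p, X') = 0 := fun p hp X' => hfC p.1 _ ⟨0, by rwa [Fin.cons_zero]⟩
    have hft_bd : ∀ n : ℕ, ∃ B : ℝ, ∀ z ∈ ((S ×ˢ (univ : Set M)) ∩ (Q ×ˢ (univ : Set M))) ×ˢ (univ : Set (Fin m → M)), ‖iteratedFDeriv ℝ n ft z‖ ≤ B := fun n => by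
      obtain ⟨B, hB⟩ := hfbd n
      refine ⟨‖κ‖ ^ n * max B 0, fun z hz => ?_⟩
      have hzκ : κ z ∈ Q ×ˢ (univ : Set (Fin (m + 1) → M)) := hκmaps ⟨hz.1.2, mem_univ _⟩
      rw [hftκ]
      refine (norm_iteratedFDeriv_comp_clm_le_of_isOpen κ hQu (hf.of_le (mod_cast le_top)) (n := n) hzκ).trans ?_
      refine mul_le_mul_of_nonneg_left ((hB _ ?_).trans (le_max_left _ _)) (pow_nonneg (norm_nonneg _) _)
      rw [hκ]; exact ⟨⟨hz.1.1.1, hz.1.2.1⟩, mem_univ _⟩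
    -- induction hypothesis at `P × M`, bound set `S ×ˢ univ`
    obtain ⟨hsm_m, hbd_m⟩ := ih (fun k => e (k + 1)) (P × M) (Q ×ˢ univ) hQt ft hft_s C hC hft_C (S ×ˢ univ) hft_bd
    -- the outer family over the open parameter set `O = Q ×ˢ T^m`
    set O : Set (P × (Fin m → V)) := Q ×ˢ Set.pi univ fun _ => T with hOdef
    have hOo : IsOpen O := hQ.prod (isOpen_set_pi finite_univ fun _ _ => hT)
    set g : P × (Fin m → V) → M → E := fun q' X₀ => H (fun k => e (k + 1)) m (P × M) ft ((q'.1, X₀), q'.2) with hgdef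
    set σ : (P × (Fin m → V)) × M →L[ℝ] (P × M) × (Fin m → V) :=
      (((ContinuousLinearMap.fst ℝ P (Fin m → V)).comp (ContinuousLinearMap.fst ℝ _ M)).prod (ContinuousLinearMap.snd ℝ _ M)).prod
        ((ContinuousLinearMap.snd ℝ P (Fin m → V)).comp (ContinuousLinearMap.fst ℝ _ M)) with hσdef
    have hσ : ∀ z : (P × (Fin m → V)) × M, σ z = ((z.1.1, z.2), z.1.2) := fun z => rfl
    have hug : uncurry g = (H (fun k => e (k + 1)) m (P × M) ft) ∘ σ := funext fun z => by simp only [uncurry, hgdef, comp_apply, hσ]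
    have hσmaps : MapsTo σ (O ×ˢ (univ : Set M)) ((Q ×ˢ univ) ×ˢ Set.pi univ fun _ => T) := fun z hz => by
      rw [hσ]; exact ⟨⟨hz.1.1, mem_univ _⟩, hz.1.2⟩
    have hg_s : ContDiffOn ℝ ∞ (uncurry g) (O ×ˢ univ) := by rw [hug]; exact hsm_m.comp σ.contDiff.contDiffOn hσmaps
    have hg_C : ∀ q' ∈ O, ∀ X₀, X₀ ∉ C → g q' X₀ = 0 := fun q' _ X₀ hX₀ => hHzero _ m (P × M) ft (q'.1, X₀) q'.2 (hft_0 (q'.1, X₀) hX₀)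
    obtain ⟨h1g, -⟩ := hread (e 0) (P × (Fin m → V)) O hOo g hg_s ⟨C, hC, hg_C⟩
    -- the re-indexing `Λ (q, θ) = ((q, Fin.tail θ), θ 0)` and `H (m+1) P f = reader ∘ Λ` on `Q ×ˢ T^{m+1}`
    set Λ : P × (Fin (m + 1) → V) →L[ℝ] (P × (Fin m → V)) × V :=
      ((ContinuousLinearMap.fst ℝ P (Fin (m + 1) → V)).prod
          ((ContinuousLinearMap.pi fun j : Fin m => ContinuousLinearMap.proj (R := ℝ) (φ := fun _ : Fin (m + 1) => V) j.succ).comp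
            (ContinuousLinearMap.snd ℝ P (Fin (m + 1) → V)))).prod
        ((ContinuousLinearMap.proj (R := ℝ) (φ := fun _ : Fin (m + 1) => V) 0).comp (ContinuousLinearMap.snd ℝ P (Fin (m + 1) → V))) with hΛdef
    have hΛ : ∀ z : P × (Fin (m + 1) → V), Λ z = ((z.1, Fin.tail z.2), z.2 0) := fun z => rfl
    set R : (P × (Fin m → V)) × V → E := fun z => Φ (e 0) (g z.1) z.2 with hRdef
    have hQT : IsOpen (Q ×ˢ Set.pi univ fun _ : Fin (m + 1) => T) := hQ.prod (isOpen_set_pi finite_univ fun _ _ => hT)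
    have hHR : ∀ z ∈ Q ×ˢ Set.pi univ (fun _ : Fin (m + 1) => T), H e (m + 1) P f z = (R ∘ Λ) z := fun z hz => by
      rw [comp_apply, hΛ, hRdef]
      simp only [hgdef]
      rw [← hHsucc e m P Q hQ f hf ⟨C, hC, hfC⟩ z.1 hz.1 z.2 fun k => hz.2 k (mem_univ _)]
    have hΛmaps : MapsTo Λ (Q ×ˢ Set.pi univ fun _ : Fin (m + 1) => T) (O ×ˢ T) := fun z hz => by
      rw [hΛ]
      exact ⟨⟨hz.1, fun j _ => hz.2 j.succ (mem_univ _)⟩, hz.2 0 (mem_univ _)⟩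
    refine ⟨(h1g.comp Λ.contDiff.contDiffOn hΛmaps).congr hHR, fun n => ?_⟩
    -- the admissible class over `(O, S′)`, `S′ = S ×ˢ T₀^m`
    set S' : Set (P × (Fin m → V)) := S ×ˢ Set.pi univ fun _ => T₀ with hS'def
    set Adm : (P × (Fin m → V) → M → E) → Prop := fun g' =>
      ContDiffOn ℝ ∞ (uncurry g') (O ×ˢ univ) ∧ (∃ C' : Set M, IsCompact C' ∧ ∀ q ∈ O, ∀ X, X ∉ C' → g' q X = 0) ∧
        ∀ k : ℕ, ∃ B : ℝ, ∀ q ∈ S' ∩ O, ∀ X : M, ‖iteratedFDeriv ℝ k (uncurry g') (q, X)‖ ≤ B with hAdmdef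
    set D : (P × (Fin m → V)) → (P × (Fin m → V) → M → E) → (P × (Fin m → V) → M → E) := fun v g' q X => fderiv ℝ (fun q'' => g' q'' X) q v with hDdef
    have hcl : ∀ g', Adm g' → ∀ v, Adm (D v g') := by
      rintro g' ⟨hs, ⟨C', hC', h0⟩, hb⟩ v
      refine ⟨contDiffOn_uncurry_fderiv_apply_blk hOo hs v, ⟨C', hC', fun q hq X hX => fderiv_apply_eq_zero_of_forall_mem_blk hOo (fun q' hq' => h0 q' hq' X hX) hq v⟩, fun k => ?_⟩
      obtain ⟨B, hB⟩ := hb (k + 1)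
      exact ⟨‖v‖ * B, fun q hq X => (norm_iteratedFDeriv_uncurry_fderiv_apply_le_blk hOo hs v ⟨hq.2, mem_univ X⟩ k).trans
        (mul_le_mul_of_nonneg_left (hB q hq X) (norm_nonneg v))⟩
    have h1 : ∀ g', Adm g' → ContDiffOn ℝ ∞ (fun z : (P × (Fin m → V)) × V => Φ (e 0) (g' z.1) z.2) (O ×ˢ T) := fun g' hg' => (hread (e 0) _ O hOo g' hg'.1 hg'.2.1).1
    have h2 : ∀ g', Adm g' → ∀ (v : P × (Fin m → V)) (z : (P × (Fin m → V)) × V), z ∈ O ×ˢ T →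
        fderiv ℝ (fun z : (P × (Fin m → V)) × V => Φ (e 0) (g' z.1) z.2) z (v, 0) = Φ (e 0) (D v g' z.1) z.2 := fun g' hg' v z hz => (hread (e 0) _ O hOo g' hg'.1 hg'.2.1).2 v z hz
    -- `hbd`: members of an admissible family over `S′ ∩ O` are a `C^∞`-bounded family (★ (X3-CORE) §3), hence ★ (E2) with `hunif` at `J = ↥(S′ ∩ O)`
    have hbd : ∀ g', Adm g' → ∀ a : ℕ, ∃ B : ℝ, ∀ q ∈ S' ∩ O, ∀ θ ∈ T ∩ (T ∩ T₀), ‖iteratedFDeriv ℝ a (Φ (e 0) (g' q)) θ‖ ≤ B := by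
      rintro g' ⟨hs, ⟨C', hC', h0⟩, hb⟩ a
      have hsl : ∀ q ∈ S' ∩ O, ContDiff ℝ ∞ (g' q) := fun q hq => contDiff_slice_of_contDiffOn_prod_univ_blk (uncurry g') hs hq.2
      have hsupp : ∀ q ∈ S' ∩ O, tsupport (g' q) ⊆ C' := fun q hq => tsupport_slice_subset_blk (uncurry g') hC'.isClosed fun X hX => h0 q hq.2 X hX
      have hbd' : ∀ k : ℕ, ∃ B : ℝ, ∀ q ∈ S' ∩ O, ∀ X ∈ C', ‖iteratedFDeriv ℝ k (g' q) X‖ ≤ B := fun k => by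
        obtain ⟨B, hB⟩ := hb k
        exact ⟨B, fun q hq X _ => (norm_iteratedFDeriv_slice_le_of_isOpen_blk (uncurry g') (hOo.prod isOpen_univ) (hs.of_le (mod_cast le_top)) ⟨hq.2, mem_univ X⟩).trans
          (hB q hq X)⟩
      obtain ⟨B, hB⟩ := exists_forall_norm_iteratedFDeriv_le_of_uniform_bounds_on_inter (Φ (e 0)) a S' O (T ∩ T₀)
        (fun Gf hGf hGfc => hunif (e 0) (↥(S' ∩ O)) Gf hGf hGfc a) g' hsl hC' hsupp hbd'
      exact ⟨B, fun q hq θ hθ => hB q hq θ hθ.2⟩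
    -- our `g` is admissible: jointly bounded jets from the induction hypothesis (all `X₀`, S-form)
    have hg_adm : Adm g := by
      refine ⟨hg_s, ⟨C, hC, hg_C⟩, fun k => ?_⟩
      obtain ⟨B, hB⟩ := hbd_m k
      refine ⟨‖σ‖ ^ k * max B 0, fun q' hq' X₀ => ?_⟩
      have hOt : IsOpen ((Q ×ˢ (univ : Set M)) ×ˢ Set.pi univ fun _ : Fin m => T) := hQt.prod (isOpen_set_pi finite_univ fun _ _ => hT)
      have hz : σ (q', X₀) ∈ (Q ×ˢ (univ : Set M)) ×ˢ Set.pi univ fun _ : Fin m => T := hσmaps ⟨hq'.2, mem_univ _⟩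
      have hle := norm_iteratedFDeriv_comp_clm_le_of_isOpen σ hOt (hsm_m.of_le (mod_cast le_top)) (n := k) hz
      rw [← hug] at hle
      refine hle.trans ((mul_le_mul_of_nonneg_left ((hB _ ?_).trans (le_max_left _ _)) (pow_nonneg (norm_nonneg _) _)))
      rw [hσ]
      exact ⟨⟨⟨hq'.1.1, mem_univ _⟩, hq'.2.1, mem_univ _⟩, fun j _ => ⟨hq'.2.2 j (mem_univ _), hq'.1.2 j (mem_univ _)⟩⟩
    -- ★ (E1) on the product region `(S′ ∩ O) ×ˢ (T ∩ T₀)`, then pull back along `Λ`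
    obtain ⟨B, hB⟩ := exists_forall_norm_iteratedFDeriv_blockReader_le_of_uniform_on hOo hT (Φ (e 0)) Adm D hcl h1 h2 S' (T ∩ T₀) hbd g hg_adm n
    have hOT : IsOpen (O ×ˢ T) := hOo.prod hT
    refine ⟨‖Λ‖ ^ n * max B 0, fun z hz => ?_⟩
    have hzQ : z ∈ Q ×ˢ Set.pi univ (fun _ : Fin (m + 1) => T) := ⟨hz.1.2, fun j _ => (hz.2 j (mem_univ _)).1⟩
    have hzΛ : Λ z ∈ O ×ˢ T := hΛmaps hzQ
    have hle := norm_iteratedFDeriv_comp_clm_le_of_isOpen Λ hOT ((h1 g hg_adm).of_le (mod_cast le_top)) (n := n) hzΛ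
    have hev : (R ∘ Λ) =ᶠ[𝓝 z] H e (m + 1) P f := Filter.eventuallyEq_of_mem (hQT.mem_nhds hzQ) fun y hy => (hHR y hy).symm
    rw [(hev.iteratedFDeriv ℝ n).eq_of_nhds] at hle
    refine hle.trans (mul_le_mul_of_nonneg_left ((hB _ ?_).trans (le_max_left _ _)) (pow_nonneg (norm_nonneg _) _))
    rw [hΛ]
    exact ⟨⟨⟨hz.1.1, fun j _ => (hz.2 j.succ (mem_univ _)).2⟩, ⟨hz.1.2, fun j _ => (hz.2 j.succ (mem_univ _)).1⟩⟩, (hz.2 0 (mem_univ _)).1, hz.2 0 (mem_univ _)⟩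

/-- **The compact-`K` form** (the shape of ★ (X3-asm)): for `K ⊆ Q` compact the base jets are bounded on `K ×ˢ C^m` (continuity) and vanish off it, so the S-form applies with `S := K`.
[cite: Varadarajan1977, Part I §1.12] [cite: Bouaziz1994IntegralesOrbitales, §3.1 (I₁)–(I₂) p. 579] [cite: HormanderALPDO1, §1.1 Thm. 1.1.8; §2.1] -/
theorem contDiffOn_and_forall_bound_nestedBlockReaders_of_isCompact {ι : Type*} (Φ : ι → (M → E) → V → E) {T : Set V} (hT : IsOpen T) (T₀ : Set V)
    (hunif : ∀ (i : ι) (J : Type) (Gf : M → lp (fun _ : J => E) ⊤), ContDiff ℝ ∞ Gf → HasCompactSupport Gf → ∀ n : ℕ,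
      ∃ B : ℝ, ∀ θ ∈ T ∩ T₀, ∀ ℓ : lp (fun _ : J => E) ⊤ →L[ℝ] E, ‖iteratedFDeriv ℝ n (Φ i (fun X => ℓ (Gf X))) θ‖ ≤ ‖ℓ‖ * B)
    (hread : ∀ (i : ι) (P' : Type) [NormedAddCommGroup P'] [NormedSpace ℝ P'] [FiniteDimensional ℝ P'] (O : Set P'), IsOpen O → ∀ g : P' → M → E,
      ContDiffOn ℝ ∞ (uncurry g) (O ×ˢ univ) → (∃ C : Set M, IsCompact C ∧ ∀ q ∈ O, ∀ X, X ∉ C → g q X = 0) →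
        ContDiffOn ℝ ∞ (fun z : P' × V => Φ i (g z.1) z.2) (O ×ˢ T) ∧
        ∀ (v : P') (z : P' × V), z ∈ O ×ˢ T → fderiv ℝ (fun z : P' × V => Φ i (g z.1) z.2) z (v, 0) = Φ i (fun X => fderiv ℝ (fun q' => g q' X) z.1 v) z.2)
    (H : (ℕ → ι) → ∀ (m : ℕ) (P' : Type), (P' × (Fin m → M) → E) → (P' × (Fin m → V) → E))
    (hH0 : ∀ (e : ℕ → ι) (P' : Type) (f : P' × (Fin 0 → M) → E) (q : P') (θ : Fin 0 → V), H e 0 P' f (q, θ) = f (q, fun k => k.elim0))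
    (hHsucc : ∀ (e : ℕ → ι) (m : ℕ) (P' : Type) [NormedAddCommGroup P'] [NormedSpace ℝ P'] (Q : Set P'), IsOpen Q →
      ∀ (f : P' × (Fin (m + 1) → M) → E),
      ContDiffOn ℝ ∞ f (Q ×ˢ univ) → (∃ C : Set M, IsCompact C ∧ ∀ (q : P') (X : Fin (m + 1) → M), (∃ k, X k ∉ C) → f (q, X) = 0) →
      ∀ q ∈ Q, ∀ θ : Fin (m + 1) → V, (∀ k, θ k ∈ T) →
        H e (m + 1) P' f (q, θ) = Φ (e 0) (fun X₀ => H (fun k => e (k + 1)) m (P' × M) (fun p => f (p.1.1, Fin.cons p.1.2 p.2)) ((q, X₀), Fin.tail θ)) (θ 0))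
    (hHzero : ∀ (e : ℕ → ι) (m : ℕ) (P' : Type) (f : P' × (Fin m → M) → E) (q : P') (θ : Fin m → V),
      (∀ X, f (q, X) = 0) → H e m P' f (q, θ) = 0)
    (m : ℕ) (e : ℕ → ι) (P : Type) [NormedAddCommGroup P] [NormedSpace ℝ P] [FiniteDimensional ℝ P] {Q : Set P} (hQ : IsOpen Q)
    (f : P × (Fin m → M) → E) (hf : ContDiffOn ℝ ∞ f (Q ×ˢ univ)) {C : Set M} (hC : IsCompact C) (hfC : ∀ (q : P) (X : Fin m → M), (∃ k, X k ∉ C) → f (q, X) = 0)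
    {K : Set P} (hK : IsCompact K) (hKQ : K ⊆ Q) :
    ContDiffOn ℝ ∞ (H e m P f) (Q ×ˢ Set.pi univ fun _ => T) ∧
      ∀ n : ℕ, ∃ B : ℝ, ∀ z ∈ K ×ˢ Set.pi univ (fun _ => T ∩ T₀), ‖iteratedFDeriv ℝ n (H e m P f) z‖ ≤ B := by
  -- base jets are bounded on `(K ∩ Q) ×ˢ univ`: continuous on the compact `K ×ˢ C^m`, zero near points off it
  have hfbd : ∀ n : ℕ, ∃ B : ℝ, ∀ z ∈ (K ∩ Q) ×ˢ (univ : Set (Fin m → M)), ‖iteratedFDeriv ℝ n f z‖ ≤ B := by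
    intro n
    have hO : IsOpen (Q ×ˢ (univ : Set (Fin m → M))) := hQ.prod isOpen_univ
    have hcont : ContinuousOn (fun z => ‖iteratedFDeriv ℝ n f z‖) (Q ×ˢ (univ : Set (Fin m → M))) :=
      ((hf.continuousOn_iteratedFDerivWithin (m := n) (mod_cast le_top) hO.uniqueDiffOn).congr
        fun z hz => (iteratedFDerivWithin_of_isOpen n hO hz).symm).norm
    have hKc : IsCompact (K ×ˢ Set.pi univ fun _ : Fin m => C) := hK.prod (isCompact_univ_pi fun _ => hC)
    obtain ⟨B, hB⟩ := hKc.exists_bound_of_continuousOn (hcont.mono (prod_mono hKQ (subset_univ _)))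
    refine ⟨max B 0, fun z hz => ?_⟩
    by_cases hX : ∀ k, z.2 k ∈ C
    · have h := hB z ⟨hz.1.1, fun k _ => hX k⟩
      rw [Real.norm_eq_abs, abs_norm] at h
      exact h.trans (le_max_left _ _)
    · push Not at hX
      obtain ⟨k, hk⟩ := hX
      have hev : f =ᶠ[𝓝 z] fun _ => 0 := by
        have hopen : IsOpen {y : P × (Fin m → M) | y.2 k ∈ Cᶜ} :=
          hC.isClosed.isOpen_compl.preimage ((continuous_apply k).comp continuous_snd)
        filter_upwards [hopen.mem_nhds (show z ∈ {y : P × (Fin m → M) | y.2 k ∈ Cᶜ} from hk)] with y hy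
        exact hfC y.1 y.2 ⟨k, hy⟩
      rw [iteratedFDeriv_eq_zero_of_eventuallyEq_zero_blk hev n, norm_zero]
      exact le_max_right _ _
  obtain ⟨hsm, hbd⟩ := contDiffOn_and_forall_bound_nestedBlockReaders Φ hT T₀ hunif hread H hH0 hHsucc hHzero m e P Q hQ f hf C hC hfC K hfbd
  refine ⟨hsm, fun n => ?_⟩
  obtain ⟨B, hB⟩ := hbd n
  exact ⟨B, fun z hz => hB z ⟨⟨hz.1, hKQ hz.1⟩, hz.2⟩⟩

end Peeling

end Literature.Analysis.Calculus

end
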